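import Summits.CriticalPhenomena.SAWScalingLimit.Theorems.SimpleSubseqLimits.Negative.SimpleSubseqLimitsThickeningNecessity
import Literature.Probability.RandomPlanarGeometry.SimpleCurves
import HarnessLib

/-!
# Line `past-shadowing-costs-halves` (crux `SAWLoopFugacityFlow.SimpleSubseqLimits`, stmt-CriticalPhenomena-4982):
the shadow-decay input is PINNED — implied by the summit conjecture, necessary for the crux given `EventualTight`

Support file (lead prover c1), vocabulary-compatible with BOTH live lines of the crux: the sibling line
`marked-point-revisit` (v2) has the single lattice stub `stub_shadowDecay : IsEndpointApprox D a b →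
ShadowDecayAt D a b`, and this line's G-type input `SlitShadowDecay` is a sub-event bound of `ShadowDecay`
(`RootReturnPinned.slitShadowDecay_of_shadowDecay`). Here `ShadowDecay` itself is pinned from both sides:

* `shadowDecay_of_sawScalingLimit : SAWScalingLimit → ShadowDecay` (registered anchor
  `stub_shadowDecayPinned`): the input is not over-strong in truth value;
* `shadowDecay_of_crux : EventualTight → SimpleSubseqLimits → ShadowDecay`: the input is NECESSARY for
  the crux given tightness — no proof of the crux under `EventualTight` avoids proving it.

Both come from the landed necessity principle for closed antitone thickenings
(`Negative.exists_limsup_law_le_of_sawScalingLimit_of_not_simple` / `…_of_crux_of_not_simple`, p84995)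
applied to `F n = closure (nearShadowEvent η ρ (1/(n+1)))`, whose intersection contains no SIMPLE class
(`not_mem_closure_nearShadowEvent_forall_of_simple`): sup-close representatives `γₙ` of a simple `e`
carry near-shadowing data `vₙ ≤ s₀ⁿ ≤ tₙ` with `ρ < |γₙ vₙ − γₙ s₀ⁿ|` and `|γₙ tₙ − γₙ vₙ| < 1/(n+1)`
(the past witness of the FIRST point of the stretch); along a subsequence `(s₀ⁿ, tₙ, vₙ) → (s₀, t, v)`
with `e t = e v`, so `t = v ≤ s₀ ≤ t` by injectivity, forcing `|e v − e s₀| = 0 ≥ ρ > 0`.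
The vocabulary (`NearShadows`, `nearShadowEvent`, `ShadowDecayAt`, `ShadowDecay`) is VERBATIM the
registered skeleton's (`Cruxes/SimpleSubseqLimits/Lines/past_shadowing_costs_halves.lean`) and the
sibling's (`Theorems/…StubShadowPassage.lean`), so the theorems transfer by `Iff.rfl`.
-/

noncomputable section

open MeasureTheory Filter Topology Set Metric
open scoped ENNReal NNReal unitInterval

namespace Summit.CriticalPhenomena.SAWScalingLimit.Theorems.SimpleSubseqLimits.PastShadowing.ShadowDecayPinned

open Literature.Probability.RandomPlanarGeometry Literature.Probability.RandomPlanarGeometry.SAW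
open Literature.Probability.LatticeModels
open Summit.CriticalPhenomena.SAWScalingLimit.Theses.SAWLoopFugacityFlow (SimpleSubseqLimits EventualTight)
open Summit.CriticalPhenomena.SAWScalingLimit.Theorems.SimpleSubseqLimits.Negative
  (exists_limsup_law_le_of_sawScalingLimit_of_not_simple exists_limsup_law_le_of_crux_of_not_simple)

/-! ## Vocabulary (verbatim the registered skeleton) -/

/-- Lattice-visible **`ε`-near shadowing**: after `s₀`, a stretch of displacement `> η` stays
within (open) distance `ε` of past points at distance `> ρ` from `γ s₀`. [folklore] -/
def NearShadows (γ : Curve ℂ) (η ρ ε : ℝ) : Prop :=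
  ∃ s₀ t t' : I, s₀ ≤ t ∧ t ≤ t' ∧ η < dist (γ t) (γ t') ∧
    ∀ u : I, t ≤ u → u ≤ t' → ∃ v : I, v ≤ s₀ ∧ ρ < dist (γ v) (γ s₀) ∧ dist (γ u) (γ v) < ε

/-- The event "some representative `ε`-nearly `(η, ρ)`-shadows its own past". [folklore] -/
def nearShadowEvent (η ρ ε : ℝ) : Set (CurveClass ℂ) :=
  {c | ∃ γ : Curve ℂ, CurveClass.mk γ = c ∧ NearShadows γ η ρ ε}

/-- **Discrete shadow decay at `(D; a_δ, b_δ)`** (verbatim the skeleton's / the sibling line's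
`ShadowDecayAt`). [folklore] -/
def ShadowDecayAt (D : DobrushinDomain) (a b : ℝ → Site 2) : Prop :=
  ∀ η ρ θ : ℝ, 0 < η → 0 < ρ → 0 < θ → ∃ ε : ℝ, 0 < ε ∧
    ∀ᶠ δ in 𝓝[>] (0 : ℝ),
      law D.carrier δ (a δ) (b δ) {γ | γ.curve ∈ nearShadowEvent η ρ ε} ≤ ENNReal.ofReal θ

/-- Shadow decay along EVERY endpoint approximation (verbatim the skeleton's `ShadowDecay`; an open
statement of this crux — deliberately untagged). -/
def ShadowDecay : Prop :=
  ∀ (D : DobrushinDomain) (a b : ℝ → Site 2), IsEndpointApprox D a b → ShadowDecayAt D a b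

/-! ## Reparametrisation and monotonicity of near-shadowing -/

/-- Near-shadowing is invariant under reparametrisation (all clauses are order/metric statements on
the values). [folklore] -/
theorem nearShadows_reparam {γ : Curve ℂ} {η ρ ε : ℝ} (h : NearShadows γ η ρ ε) (φ : I ≃o I) :
    NearShadows (γ.reparam φ) η ρ ε := by
  obtain ⟨s₀, t, t', hst, htt, hd, H⟩ := h
  refine ⟨φ.symm s₀, φ.symm t, φ.symm t', φ.symm.monotone hst, φ.symm.monotone htt, ?_, ?_⟩
  · show η < dist (γ (φ (φ.symm t))) (γ (φ (φ.symm t')))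
    rw [φ.apply_symm_apply, φ.apply_symm_apply]; exact hd
  · intro u hu hu'
    have h1 : t ≤ φ u := by simpa using φ.monotone hu
    have h2 : φ u ≤ t' := by simpa using φ.monotone hu'
    obtain ⟨v, hv, hρv, hdv⟩ := H (φ u) h1 h2
    refine ⟨φ.symm v, φ.symm.monotone hv, ?_, ?_⟩
    · show ρ < dist (γ (φ (φ.symm v))) (γ (φ (φ.symm s₀)))
      rw [φ.apply_symm_apply, φ.apply_symm_apply]; exact hρv
    · show dist (γ (φ u)) (γ (φ (φ.symm v))) < ε
      rw [φ.apply_symm_apply]; exact hdv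

/-- Near-shadowing is monotone in the width `ε`. [folklore] -/
theorem nearShadows_mono {γ : Curve ℂ} {η ρ ε ε' : ℝ} (h : NearShadows γ η ρ ε) (hε : ε ≤ ε') :
    NearShadows γ η ρ ε' := by
  obtain ⟨s₀, t, t', hst, htt, hd, H⟩ := h
  refine ⟨s₀, t, t', hst, htt, hd, fun u hu hu' => ?_⟩
  obtain ⟨v, hv, hρv, hdv⟩ := H u hu hu'
  exact ⟨v, hv, hρv, hdv.trans_le hε⟩

/-! ## The core: no simple class lies in all the closed thickenings -/

/-- **Core.** For `ρ > 0`, a SIMPLE class cannot lie in `closure (nearShadowEvent η ρ (1/(n+1)))` for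
every `n`: the past witness `vₙ ≤ s₀ⁿ ≤ tₙ` of the first point `tₙ` of the stretch is `1/(n+1)`-close
to it in value, so along a subsequence the limits `v ≤ s₀ ≤ t` have `e t = e v`, hence `t = v = s₀`
by injectivity, contradicting `ρ ≤ |e v − e s₀|`. [folklore] -/
theorem not_mem_closure_nearShadowEvent_forall_of_simple {η ρ : ℝ} (hρ : 0 < ρ)
    {c : CurveClass ℂ} (hc : c ∈ CurveClass.simple)
    (h : ∀ n : ℕ, c ∈ closure (nearShadowEvent η ρ (1 / ((n : ℝ) + 1)))) : False := by
  obtain ⟨e, he, rfl⟩ := hc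
  have hex : ∀ n : ℕ, ∃ γ : Curve ℂ, NearShadows γ η ρ (1 / ((n : ℝ) + 1)) ∧
      ∀ t, dist (e t) (γ t) < 1 / ((n : ℝ) + 1) := by
    intro n
    obtain ⟨b, hb, hd⟩ :=
      Metric.mem_closure_iff.1 (h n) _ (by positivity : (0 : ℝ) < 1 / ((n : ℝ) + 1))
    obtain ⟨γ, rfl, hγ⟩ := hb
    change dist (SeparationQuotient.mk e) (SeparationQuotient.mk γ) < _ at hd
    rw [SeparationQuotient.dist_mk] at hd
    obtain ⟨φ, hφ⟩ := Curve.exists_dist_reparam_lt hd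
    exact ⟨γ.reparam φ, nearShadows_reparam hγ φ,
      fun t => (ContinuousMap.dist_apply_le_dist t).trans_lt hφ⟩
  choose γ hγ hclose using hex
  choose s₀ t t' hst _htt _hfar H using hγ
  have hv : ∀ n, ∃ v : I, v ≤ s₀ n ∧ ρ < dist (γ n v) (γ n (s₀ n)) ∧
      dist (γ n (t n)) (γ n v) < 1 / ((n : ℝ) + 1) := fun n => H n (t n) le_rfl (_htt n)
  choose v hvs hvρ hvd using hv
  obtain ⟨⟨s₁, t₁, v₁⟩, ψ, hψ, hlim⟩ :=
    CompactSpace.tendsto_subseq (fun n => (s₀ n, t n, v n))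
  have hsl : Tendsto (fun k => s₀ (ψ k)) atTop (𝓝 s₁) :=
    (continuous_fst.tendsto _).comp hlim
  have htl : Tendsto (fun k => t (ψ k)) atTop (𝓝 t₁) :=
    (continuous_fst.comp continuous_snd).tendsto _ |>.comp hlim
  have hvl : Tendsto (fun k => v (ψ k)) atTop (𝓝 v₁) :=
    (continuous_snd.comp continuous_snd).tendsto _ |>.comp hlim
  have herr : Tendsto (fun k : ℕ => 1 / ((ψ k : ℝ) + 1)) atTop (𝓝 0) := by
    have h1 : Tendsto (fun k : ℕ => 1 / ((k : ℝ) + 1)) atTop (𝓝 0) :=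
      tendsto_one_div_add_atTop_nhds_zero_nat
    refine squeeze_zero (fun k => by positivity) (fun k => ?_) h1
    have : (k : ℝ) ≤ ψ k := by exact_mod_cast hψ.id_le k
    exact one_div_le_one_div_of_le (by positivity) (by linarith)
  have hval : ∀ {u : ℕ → I} {u₀ : I}, Tendsto (fun k => u (ψ k)) atTop (𝓝 u₀) →
      Tendsto (fun k => γ (ψ k) (u (ψ k))) atTop (𝓝 (e u₀)) := by
    intro u u₀ hu
    rw [tendsto_iff_dist_tendsto_zero]
    have h2 : Tendsto (fun k => dist (e (u (ψ k))) (e u₀)) atTop (𝓝 0) := by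
      rw [← tendsto_iff_dist_tendsto_zero]
      exact (e.continuous.tendsto u₀).comp hu
    refine squeeze_zero (fun k => dist_nonneg) (fun k => ?_)
      (by simpa only [add_zero] using herr.add h2)
    calc dist (γ (ψ k) (u (ψ k))) (e u₀)
        ≤ dist (γ (ψ k) (u (ψ k))) (e (u (ψ k))) + dist (e (u (ψ k))) (e u₀) := dist_triangle _ _ _
      _ ≤ 1 / ((ψ k : ℝ) + 1) + dist (e (u (ψ k))) (e u₀) := by
          gcongr; rw [dist_comm]; exact (hclose (ψ k) _).le
  have hvs' := hval hsl
  have hvt := hval htl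
  have hvv := hval hvl
  have hfar' : ρ ≤ dist (e v₁) (e s₁) :=
    ge_of_tendsto' (hvv.dist hvs') fun k => (hvρ (ψ k)).le
  have heq : e t₁ = e v₁ := by
    have hh1 : Tendsto (fun k => dist (γ (ψ k) (t (ψ k))) (γ (ψ k) (v (ψ k)))) atTop
        (𝓝 (dist (e t₁) (e v₁))) := hvt.dist hvv
    have hh2 : Tendsto (fun k => dist (γ (ψ k) (t (ψ k))) (γ (ψ k) (v (ψ k)))) atTop (𝓝 0) :=
      squeeze_zero (fun k => dist_nonneg) (fun k => (hvd (ψ k)).le) herr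
    exact dist_eq_zero.1 (tendsto_nhds_unique hh1 hh2)
  have h1 : v₁ ≤ s₁ := le_of_tendsto_of_tendsto' hvl hsl fun k => hvs (ψ k)
  have h2 : s₁ ≤ t₁ := le_of_tendsto_of_tendsto' hsl htl fun k => hst (ψ k)
  have h3 : t₁ = v₁ := he heq
  have h4 : s₁ = v₁ := le_antisymm (h3 ▸ h2) h1
  rw [h4, dist_self] at hfar'
  exact absurd hfar' (not_le.2 hρ)

/-! ## The closed thickenings and their core -/

/-- The closed `1/(n+1)`-thickenings of the shadowing configuration. [folklore] -/
def thick (η ρ : ℝ) (n : ℕ) : Set (CurveClass ℂ) :=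
  closure (nearShadowEvent η ρ (1 / ((n : ℝ) + 1)))

/-- The thickenings are closed. [folklore] -/
theorem isClosed_thick (η ρ : ℝ) (n : ℕ) : IsClosed (thick η ρ n) :=
  isClosed_closure

/-- The thickenings decrease in `n`. [folklore] -/
theorem antitone_thick (η ρ : ℝ) : Antitone (thick η ρ) := by
  intro m n hmn
  have hmn' : (m : ℝ) ≤ n := by exact_mod_cast hmn
  refine closure_mono ?_
  rintro c ⟨γ, rfl, hγ⟩
  exact ⟨γ, rfl, nearShadows_mono hγ (one_div_le_one_div_of_le (by positivity) (by linarith))⟩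

/-- The intersection of the thickenings contains no simple class (`ρ > 0`). [folklore] -/
theorem thick_core {η ρ : ℝ} (hρ : 0 < ρ) (c : CurveClass ℂ) (hc : ∀ n, c ∈ thick η ρ n) :
    c ∉ CurveClass.simple := fun hs =>
  not_mem_closure_nearShadowEvent_forall_of_simple hρ hs hc

/-! ## `ShadowDecay` from a necessity principle; the two pins -/

/-- **`ShadowDecay` from any necessity principle for closed antitone thickenings with simple-free
core** (the common shape of the two landed principles): at `(η, ρ, θ)` the principle gives `n` with
`limsup_δ P_δ[curve ∈ thick n] ≤ θ/2 < θ`, hence eventually `P_δ[curve ∈ nearShadowEvent η ρ (1/(n+1))] ≤ θ`;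
take `ε = 1/(n+1)`. [folklore] -/
theorem shadowDecay_of_principle
    (Hp : ∀ (D : DobrushinDomain) (a b : ℝ → Site 2), IsEndpointApprox D a b →
      ∀ {F : ℕ → Set (CurveClass ℂ)}, (∀ n, IsClosed (F n)) → Antitone F →
        (∀ c : CurveClass ℂ, (∀ n, c ∈ F n) → c ∉ CurveClass.simple) → ∀ {θ : ℝ≥0∞}, 0 < θ →
          ∃ n, limsup (fun δ => law D.carrier δ (a δ) (b δ) {γ | γ.curve ∈ F n}) (𝓝[>] (0 : ℝ)) ≤ θ) :
    ShadowDecay := by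
  intro D a b hab η ρ θ _hη hρ hθ
  have hθ' : (0 : ℝ≥0∞) < ENNReal.ofReal θ / 2 :=
    ENNReal.half_pos (ENNReal.ofReal_pos.2 hθ).ne'
  obtain ⟨n, hn⟩ := Hp D a b hab (isClosed_thick η ρ) (antitone_thick η ρ) (thick_core hρ) hθ'
  refine ⟨1 / ((n : ℝ) + 1), by positivity, ?_⟩
  have hle : limsup (fun δ => law D.carrier δ (a δ) (b δ)
      {γ | γ.curve ∈ nearShadowEvent η ρ (1 / ((n : ℝ) + 1))}) (𝓝[>] (0 : ℝ)) ≤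
        ENNReal.ofReal θ / 2 := by
    refine le_trans (Filter.limsup_le_limsup (Eventually.of_forall fun δ => ?_)) hn
    exact measure_mono fun γ hγ => subset_closure hγ
  have hlt : limsup (fun δ => law D.carrier δ (a δ) (b δ)
      {γ | γ.curve ∈ nearShadowEvent η ρ (1 / ((n : ℝ) + 1))}) (𝓝[>] (0 : ℝ)) < ENNReal.ofReal θ :=
    hle.trans_lt (ENNReal.half_lt_self (ENNReal.ofReal_pos.2 hθ).ne' ENNReal.ofReal_ne_top)
  filter_upwards [Filter.eventually_lt_of_limsup_lt hlt] with δ hδ using hδ.le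

/-- **`ShadowDecay` is implied by the summit conjecture** `SAWScalingLimit` (so neither this line's
G-type input `SlitShadowDecay` nor the sibling line's `ShadowDecayAt` is over-strong in truth value).
[folklore] -/
theorem shadowDecay_of_sawScalingLimit (h : _root_.SAWScalingLimit) : ShadowDecay :=
  shadowDecay_of_principle fun _ _ _ hab _ hF hanti hcore _ hθ =>
    exists_limsup_law_le_of_sawScalingLimit_of_not_simple h hab hF hanti hcore hθ

/-- **Registered anchor `stub_shadowDecayPinned`** of this support file: `ShadowDecay` is implied by
the summit conjecture. [folklore] -/
theorem stub_shadowDecayPinned : _root_.SAWScalingLimit → ShadowDecay :=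
  shadowDecay_of_sawScalingLimit

/-- **`ShadowDecay` is NECESSARY for the crux given `EventualTight`** (so the shadow-type inputs of both
live lines waste no strength: any proof of the crux under tightness proves them on the way). [folklore] -/
theorem shadowDecay_of_crux (hT : EventualTight) (hS : SimpleSubseqLimits) : ShadowDecay :=
  shadowDecay_of_principle fun _ _ _ hab _ hF hanti hcore _ hθ =>
    exists_limsup_law_le_of_crux_of_not_simple hT hS hab hF hanti hcore hθ

/-- Pointwise form for the sibling line's stub shape: under the summit conjecture every endpoint
approximation has shadow decay. [folklore] -/
theorem shadowDecayAt_of_sawScalingLimit (h : _root_.SAWScalingLimit) {D : DobrushinDomain}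
    {a b : ℝ → Site 2} (hab : IsEndpointApprox D a b) : ShadowDecayAt D a b :=
  shadowDecay_of_sawScalingLimit h D a b hab

/-- Pointwise form: under `EventualTight` the crux forces shadow decay at every endpoint
approximation. [folklore] -/
theorem shadowDecayAt_of_crux (hT : EventualTight) (hS : SimpleSubseqLimits) {D : DobrushinDomain}
    {a b : ℝ → Site 2} (hab : IsEndpointApprox D a b) : ShadowDecayAt D a b :=
  shadowDecay_of_crux hT hS D a b hab

end Summit.CriticalPhenomena.SAWScalingLimit.Theorems.SimpleSubseqLimits.PastShadowing.ShadowDecayPinned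

end
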